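import Mathlib
import HarnessLib
import Literature.Probability.MarkovChains.HMCExpDeltaH
import Summits.Ventures.LatticeQCDFlow.Exactness.PTBCSwap

/-!
# The PTBC swap monitor: `⟨e^{−ΔS}⟩ = 1` and `⟨ΔS⟩ ≥ 0` for the replica-exchange proposal

HONEST FRAMING: exact (Metropolis-corrected) sampling algorithms for lattice gauge theory;
figures of merit are autocorrelation/cost numbers at stated couplings and volumes; no
continuum-physics claim.

Venture `LatticeQCDFlow` (cell pub-lqcd), topic `Exactness`; FANOUT row 22 (`su3-ptbc`, the E4
parallel-tempering-on-boundary-conditions arm).  NEW WORK of the cell = an INSTANCE of the tree's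
Literature theorem `Literature.Probability.MarkovChains.HMC.integral_exp_neg_deltaH`
(Montvay–Münster (7.237)–(7.238), proved there for ANY volume-preserving map) for the PTBC swap
proposal; nothing here is cited as a fact.

## Content

Two replica slots with actions `S₁, S₂ : Ω → ℝ` over a reference measure `vol`; the slot pair holds
`z = (x, y)`, its joint energy is `pairEnergy S₁ S₂ z = S₁ x + S₂ y`, and the joint equilibrium law
is the Boltzmann law `e^{−S₁(x) − S₂(y)} (vol ⊗ vol) / Z` (`HMC.boltzmann (vol.prod vol) (pairEnergy S₁ S₂)`,
i.e. the product of the two replica laws).  The exchange PROPOSAL is `z ↦ z.swap`, and the Metropolis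
test of `PTBCSwap.lean` (`involAccept_ptbcSwap`) uses
`ΔS(x, y) = S₁ y + S₂ x − S₁ x − S₂ y = pairEnergy (z.swap) − pairEnergy z` (`swapDelta_eq`).

* `integral_exp_neg_swapDelta` — **`⟨e^{−ΔS}⟩ = 1`** over PROPOSED swaps in equilibrium, exactly,
  because `Prod.swap` preserves `vol ⊗ vol` (Mathlib `Measure.measurePreserving_swap`): the free
  exactness monitor row 22 logs per replica pair in every run (CARD-su3-ptbc §3 tripwire
  '⟨e^{−ΔS}⟩ over proposed swaps ≠ 1 within 3σ'; chain-header field `exp_minus_dS_per_pair`).  A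
  measured deviation beyond statistics falsifies the ΔS bookkeeping (e.g. a wrong defect-plaquette
  sum — cf. `PTBCSwapEnergy.lean`) or equilibration, never 'swap inaccuracy'.
* `integral_swapDelta_nonneg` — **`⟨ΔS⟩ ≥ 0`** (Jensen), the reason swap energies are positive on
  average although every individual swap is reversible.

## Not here

The swap's detailed balance / invariance (`PTBCSwap.lean`); the Gaussian model of the acceptance
(`Literature/Probability/Distributions/GaussianMetropolisAcceptance.lean`: `⟨e^{−Δ}⟩ = 1` forces
mean = variance/2, `⟨min(1, e^{−Δ})⟩ = erfc(√(w/8))`); any measured number.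
-/

noncomputable section

namespace Summit.Ventures.LatticeQCDFlow.Exactness

open MeasureTheory Real
open Literature.Probability.MarkovChains

variable {Ω : Type*} [MeasurableSpace Ω]

/-- The joint energy of a pair of replica slots holding `z = (x, y)`: `S₁ x + S₂ y`. -/
def pairEnergy (S₁ S₂ : Ω → ℝ) (z : Ω × Ω) : ℝ := S₁ z.1 + S₂ z.2

/-- The PTBC swap energy of the pair `z = (x, y)`: `ΔS = S₁ y + S₂ x − S₁ x − S₂ y` (the exponent of
the Metropolis test `min (1, e^{−ΔS})` of `involAccept_ptbcSwap`). -/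
def swapDelta (S₁ S₂ : Ω → ℝ) (z : Ω × Ω) : ℝ := S₁ z.2 + S₂ z.1 - S₁ z.1 - S₂ z.2

omit [MeasurableSpace Ω] in
/-- `ΔS` is the change of the joint energy under the proposal `z ↦ z.swap`. -/
theorem swapDelta_eq (S₁ S₂ : Ω → ℝ) (z : Ω × Ω) :
    swapDelta S₁ S₂ z = pairEnergy S₁ S₂ z.swap - pairEnergy S₁ S₂ z := by
  simp only [swapDelta, pairEnergy, Prod.fst_swap, Prod.snd_swap]
  ring

/-- The joint energy is measurable for measurable actions. -/
theorem measurable_pairEnergy {S₁ S₂ : Ω → ℝ} (h₁ : Measurable S₁) (h₂ : Measurable S₂) :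
    Measurable (pairEnergy S₁ S₂) :=
  (h₁.comp measurable_fst).add (h₂.comp measurable_snd)

/-- The exchange proposal `z ↦ z.swap` preserves the product reference measure `vol ⊗ vol`. -/
theorem measurePreserving_swap_prod_self (vol : Measure Ω) [SFinite vol] :
    MeasurePreserving (Prod.swap : Ω × Ω → Ω × Ω) (vol.prod vol) (vol.prod vol) :=
  Measure.measurePreserving_swap

/-- **The swap monitor: `⟨e^{−ΔS}⟩ = 1`.**  Under the joint equilibrium law
`e^{−S₁(x) − S₂(y)} (vol ⊗ vol) / Z` of two replica slots, the expectation of `e^{−ΔS}` over the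
PROPOSED exchange is exactly `1` — for any measurable actions with `0 < Z`; instance of
`HMC.integral_exp_neg_deltaH` with the volume-preserving map `Prod.swap`. -/
theorem integral_exp_neg_swapDelta (vol : Measure Ω) [SFinite vol] {S₁ S₂ : Ω → ℝ}
    (h₁ : Measurable S₁) (h₂ : Measurable S₂)
    (hZ : 0 < HMC.partitionFn (vol.prod vol) (pairEnergy S₁ S₂)) :
    ∫ z, exp (-(swapDelta S₁ S₂ z)) ∂(HMC.boltzmann (vol.prod vol) (pairEnergy S₁ S₂)) = 1 := by
  have h := HMC.integral_exp_neg_deltaH (measurePreserving_swap_prod_self vol)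
    (measurable_pairEnergy h₁ h₂) hZ
  simp_rw [swapDelta_eq]
  exact h

/-- **`⟨ΔS⟩ ≥ 0`** (Jensen) under the same law, for an integrable `ΔS`: swap energies are
non-negative on average. -/
theorem integral_swapDelta_nonneg (vol : Measure Ω) [SFinite vol] {S₁ S₂ : Ω → ℝ}
    (h₁ : Measurable S₁) (h₂ : Measurable S₂)
    (hint : Integrable (fun z => exp (-(pairEnergy S₁ S₂ z))) (vol.prod vol))
    (hZ : 0 < HMC.partitionFn (vol.prod vol) (pairEnergy S₁ S₂))
    (hδ : Integrable (swapDelta S₁ S₂) (HMC.boltzmann (vol.prod vol) (pairEnergy S₁ S₂))) :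
    0 ≤ ∫ z, swapDelta S₁ S₂ z ∂(HMC.boltzmann (vol.prod vol) (pairEnergy S₁ S₂)) := by
  have hδ' : Integrable (fun z : Ω × Ω => pairEnergy S₁ S₂ (Prod.swap z) - pairEnergy S₁ S₂ z)
      (HMC.boltzmann (vol.prod vol) (pairEnergy S₁ S₂)) :=
    hδ.congr (Filter.Eventually.of_forall fun z => swapDelta_eq S₁ S₂ z)
  have h := HMC.integral_deltaH_nonneg (measurePreserving_swap_prod_self vol)
    (measurable_pairEnergy h₁ h₂) hint hZ hδ'
  rw [integral_congr_ae (Filter.Eventually.of_forall fun z => swapDelta_eq S₁ S₂ z)]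
  exact h

end Summit.Ventures.LatticeQCDFlow.Exactness

end
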